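import Literature.AlgebraicGeometry.HodgeTheory.BettiHodgeConjectureProductsReducedWindowCriterion
import Literature.AlgebraicGeometry.HodgeTheory.LefschetzOneOneHolds
import Literature.AlgebraicGeometry.Motives.HodgeStructureLefschetzGroupDirectSumPoints
import HarnessLib

/-!
# `HC(Y × Z)` when the window is HODGE-DISJOINT: if for every reduced-window piece `Hⁱ(Y) ⊗ Hʲ(Z) ⊂ H^{2c}(Y × Z)` the Hodge structures `H^{2n−j}(Z)` and `Hⁱ(Y)(c − n)` have no common Hodge type,
# then `Hom_HS(H^{2n−j}(Z), Hⁱ(Y)(c − n)) = 0` and `HC(Y)`, `HC(Z)` imply `HC(Y × Z)`; e.g. `HC(C × T)` for every curve `C` and every threefold `T` with `h^{2,1}(T) = 0`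
# (Voisin I §7.1.1, §7.3.1 Def. 7.22, §11.3.3 Thm. 11.38–11.40, Lemma 11.41, pp. 285–287; Deligne Hodge II 1.2.5, 2.1.13; Voisin II Prop. 9.20, proof of Prop. 10.26)

Family `hodge`, lane `lit-hodgefound` (Track 2 foundations library; Layers A1/A4), layer `Literature/AlgebraicGeometry/HodgeTheory`.  THEOREMS ONLY (no definition, no named fact, no instance;
D-0026 net debt `0`).  A morphism of `ℚ`-Hodge structures of weight `w` maps `V₁^{p,q}` into `V₂^{p,q}` (tree `HodgeStructure.Hom.map_piece_le`); as `V₁ ⊗ ℂ = ⊕_p V₁^{p,w−p}` (tree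
`iSup_piece_eq_top_holds`), a morphism `f` with `V₁^{p,w−p} = 0` or `V₂^{p,w−p} = 0` for every `p` has `f ⊗ ℂ = 0`, hence `f = 0` (`ℂ` is faithfully flat over `ℚ`; tree
`Hom.toLinearMap_eq_zero_of_baseChange_eq_zero`) — §1.  The Hodge pieces of the twisted carrier `Hⁱ(Y)(r)` (the tree's `((BettiUniverse.hodge …).tateTwist r).cast hw`) are the shifted pieces
`Hⁱ(Y)^{p+r, q+r}` (g31-#1 `HodgeModel.piece_tateTwist_cast_int`).  So when every reduced-window pair (`H^{2n−j}(Z)`, `Hⁱ(Y)(c − n)`) is Hodge-disjoint, every window morphism vanishes, the zero class induces it,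
and the seat's reduced-window criterion (g31-#14 §2) gives `HC(Y × Z)` from `HC(Y)`, `HC(Z)` — §2.  Example (§3): a smooth projective curve `C` and threefold `T`; the only reduced-window piece is
`H¹(C) ⊗ H³(T) ⊂ H⁴(C × T)`, i.e. `Hom_HS(H³(T), H¹(C)(−1))`; `H¹(C)(−1)` has types `(2,1)`, `(1,2)` only (`Hᵏ` of a smooth projective variety has no piece with a negative index; g31-#1
`HodgeModel.hodgeStructure_piece_eq_bot_of_neg`), so `h^{2,1}(T) = 0` (`= h^{1,2}(T)` by Hodge symmetry, through the tree's `conjPieceEquiv`) makes the window Hodge-disjoint: **`HC(C × T)` for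
every curve `C` and every threefold `T` with `h^{2,1}(T) = 0`** (e.g. rigid Calabi–Yau threefolds), `HC` in dimension `≤ 3` being the tree's `hodgeConjectureFor_of_dim_le_three_holds`.

WHAT IS PROVED.
* §1 **`hodgeHom_toLinearMap_eq_zero_of_forall_piece_eq_bot_or`** — a morphism of Hodge structures between Hodge-disjoint structures is zero.
* §2 **`BettiUniverse.hodgeConjectureFor_tensor_of_forall_reducedWindow_hodgeDisjoint`** — `HC(Y)`, `HC(Z)` and Hodge-disjointness on the reduced window ⇒ `HC(Y × Z)`.
* §3 **`BettiUniverse.hodgeConjectureFor_curve_tensor_threefold_of_piece_two_one_eq_bot`** — `HC(C × T)` for `dim C = 1`, `dim T = 3`, `H³(T)^{2,1} = 0`.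

THE PRINTS.  C. Voisin (2002) [VoisinHodgeI2002] §7.1.1; §7.3.1 Def. 7.22; §11.3.1 Thm. 11.30; §11.3.3 Thm. 11.38–11.40, Lemma 11.41 and pp. 285–287.  P. Deligne (1971) [DeligneHodgeII1971] 1.2.5, 2.1.6,
2.1.13.  C. Voisin (2003) [VoisinHodgeII2003] §9.2.4 Prop. 9.20, §10.2.3 proof of Prop. 10.26.  N. Bourbaki [BourbakiAlgebraI1989] Ch. II §5 no. 3 Prop. 7 (ii).  P. Deligne (2000/2006) [Deligne2000] §1.

THE OBJECTS (all the tree's).  `HodgeStructure.Hom`, `HodgeStructure.piece`, `tateTwist`, `cast`, `conjPieceEquiv`, `BettiUniverse.hodge`, `BettiUniverse.realHodgeModel`, `BettiUniverse.kunnethSummand`,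
`BettiUniverse.crossMap`, `corrAction complexOrientationFamily`, `ofRatClass`, `algebraicClasses`, `HodgeConjectureFor`; the tree's `HodgeStructure.Hom.map_piece_le`, `HodgeStructure.iSup_piece_eq_top_holds`,
`HodgeStructure.Hom.toLinearMap_eq_zero_of_baseChange_eq_zero`, `HodgeModel.piece_tateTwist_cast_int`, `HodgeModel.hodgeStructure_piece_eq_bot_of_neg`, `hodgeConjectureFor_of_dim_le_three_holds`,
the seat's g31-#14 `BettiUniverse.hodgeConjectureFor_tensor_iff_forall_hom_reducedWindow_exists_crossMap_algebraic`.

DEVIATIONS / SCOPE.  Complex orientations (through g31-#14).  No definitions.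

## References
* [VoisinHodgeI2002] C. Voisin, *Hodge Theory and Complex Algebraic Geometry I* (2002) — §7.1.1; §7.3.1 Def. 7.22; §11.3.1 Thm. 11.30; §11.3.3 Thm. 11.38–11.40, Lemma 11.41, pp. 285–287.
* [DeligneHodgeII1971] P. Deligne, *Théorie de Hodge II* (1971) — 1.2.5, 2.1.6, 2.1.13.
* [VoisinHodgeII2003] C. Voisin, *Hodge Theory and Complex Algebraic Geometry II* (2003) — §9.2.4 Prop. 9.20; §10.2.3 proof of Prop. 10.26.
* [BourbakiAlgebraI1989] N. Bourbaki, *Algebra I* (1989) — Ch. II §5 no. 3 Prop. 7 (ii).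
* [Deligne2000] P. Deligne, *The Hodge conjecture* (Clay problem description) — §1.

## Provenance
Lane `lit-hodgefound` (Hodge path, Track 2), prover seat `lit-hodgefound-p29` (generation 31), self-proposed row g31-#16 (Hodge-disjoint windows; `HC(C × T)` for `h^{2,1}(T) = 0`).
-/

noncomputable section

open scoped TensorProduct
open CategoryTheory MonoidalCategory CartesianMonoidalCategory Module Finset
open Literature.AlgebraicTopology.SingularHomology
open Literature.Geometry.Kaehler

namespace Literature.AlgebraicGeometry.HodgeTheory

open Literature.AlgebraicGeometry.Motives
open Literature.AlgebraicGeometry.Motives.HodgeStructure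

/-! ### §1 Morphisms between Hodge-disjoint Hodge structures vanish -/

/-- **A morphism of `ℚ`-Hodge structures of weight `w` between HODGE-DISJOINT structures is zero**: if for every `p` either `V₁^{p,w−p} = 0` or `V₂^{p,w−p} = 0`, then every `f ∈ Hom_HS(V₁, V₂)` vanishes
(`f ⊗ ℂ` maps `V₁^{p,q}` into `V₂^{p,q}`, the pieces span `V₁ ⊗ ℂ`, and `f ⊗ ℂ = 0 ⟹ f = 0`). [cite: VoisinHodgeI2002, §7.1.1 and §7.3.1 Def. 7.22] [cite: DeligneHodgeII1971, 1.2.5 and 2.1.6] [cite: BourbakiAlgebraI1989, Ch. II §5 no. 3 Prop. 7 (ii)] -/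
theorem hodgeHom_toLinearMap_eq_zero_of_forall_piece_eq_bot_or {V₁ V₂ : Type} [AddCommGroup V₁] [Module ℚ V₁] [AddCommGroup V₂] [Module ℚ V₂] {w : ℤ}
    {H₁ : HodgeStructure V₁ w} {H₂ : HodgeStructure V₂ w} (f : HodgeStructure.Hom H₁ H₂) (h : ∀ p : ℤ, H₁.piece p (w - p) = ⊥ ∨ H₂.piece p (w - p) = ⊥) :
    f.toLinearMap = 0 := by
  refine HodgeStructure.Hom.toLinearMap_eq_zero_of_baseChange_eq_zero ℂ fun x ↦ ?_
  -- `f ⊗ ℂ` kills every Hodge piece of `V₁`, and the pieces span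
  have hker : (⨆ p : ℤ, H₁.piece p (w - p)) ≤ LinearMap.ker (f.toLinearMap.baseChange ℂ) := by
    refine iSup_le fun p x hx ↦ LinearMap.mem_ker.2 ?_
    rcases h p with h₁ | h₂
    · rw [h₁, Submodule.mem_bot] at hx
      rw [hx, map_zero]
    · have hfx : f.toLinearMap.baseChange ℂ x ∈ H₂.piece p (w - p) := f.map_piece_le p (w - p) ⟨x, hx, rfl⟩
      rwa [h₂, Submodule.mem_bot] at hfx
  have hx : x ∈ ⨆ p : ℤ, H₁.piece p (w - p) := by
    rw [HodgeStructure.iSup_piece_eq_top_holds H₁]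
    exact Submodule.mem_top
  exact LinearMap.mem_ker.1 (hker hx)

/-! ### §2 Hodge-disjoint reduced windows -/

section Disjoint

variable {m n d : ℕ} {Y Z : SchemeOver ℂ}

variable [HodgeTensorFacts.{0, 0}]

/-- **`HC(Y)`, `HC(Z)` and a Hodge-disjoint reduced window ⇒ `HC(Y × Z)`.**  If for every reduced-window piece (`2 ≤ c`, `1 ≤ i ≤ m`, `1 ≤ j ≤ n`, `i + j = 2c`, `a + j = 2n`, `n + r = c`, `bᵢ(Y) ≠ 0`,
`bⱼ(Z) ≠ 0`, no factor of Hodge classes) and every `p` either `Hᵃ(Z)^{p, a−p} = 0` or `Hⁱ(Y)^{p+r, a−p+r} = 0`, then every `φ ∈ Hom_HS(Hᵃ(Z), Hⁱ(Y)(r))` is zero (§1), the zero class induces it, and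
the reduced-window criterion (g31-#14) applies. [cite: VoisinHodgeI2002, §7.3.1 Def. 7.22, §11.3.3 Thm. 11.38–11.40, Lemma 11.41 and pp. 285–287, §11.3.1 Thm. 11.30] [cite: DeligneHodgeII1971, 1.2.5 and 2.1.13]
[cite: VoisinHodgeII2003, §9.2.4 Prop. 9.20] [cite: Deligne2000, §1] -/
theorem BettiUniverse.hodgeConjectureFor_tensor_of_forall_reducedWindow_hodgeDisjoint (hHD : exists_isReal_hodgeModel) (hY : IsSmoothProjective m Y) (hZ : IsSmoothProjective n Z)
    (hYZ : IsSmoothProjective d (Y ⊗ Z)) (hHCY : HodgeConjectureFor m Y) (hHCZ : HodgeConjectureFor n Z)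
    (hdis : ∀ (c i j a : ℕ) (r : ℤ), 2 ≤ c → 1 ≤ i → i ≤ m → 1 ≤ j → j ≤ n → i + j = 2 * c → a + j = 2 * n → ((n : ℕ) : ℤ) + r = ((c : ℕ) : ℤ) →
      0 < Module.finrank ℚ (bettiCohomology Y i) → 0 < Module.finrank ℚ (bettiCohomology Z j) →
      (∀ a', i = 2 * a' → (BettiUniverse.hodge hHD hY (2 * a')).hodgeClasses a' ≠ ⊤) → (∀ b', j = 2 * b' → (BettiUniverse.hodge hHD hZ (2 * b')).hodgeClasses b' ≠ ⊤) →
      ∀ p : ℤ, (BettiUniverse.hodge hHD hZ a).piece p (((a : ℕ) : ℤ) - p) = ⊥ ∨ (BettiUniverse.hodge hHD hY i).piece (p + r) (((a : ℕ) : ℤ) - p + r) = ⊥) :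
    HodgeConjectureFor d (Y ⊗ Z) := by
  refine (BettiUniverse.hodgeConjectureFor_tensor_iff_forall_hom_reducedWindow_exists_crossMap_algebraic hHD hY hZ hYZ hHCY hHCZ).2
    fun c i j a r hc hi him hj hjn hij haj hab hr hw hbY hbZ hnY hnZ φ ↦ ⟨0, ?_, fun v ↦ ?_⟩
  · rw [map_zero, map_zero]
    exact Submodule.zero_mem _
  · have hφ : φ.toLinearMap = 0 := hodgeHom_toLinearMap_eq_zero_of_forall_piece_eq_bot_or φ fun p ↦ by
      rcases hdis c i j a r hc hi him hj hjn hij haj hr hbY hbZ hnY hnZ p with h | h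
      · exact Or.inl h
      · -- the pieces of the twisted carrier `Hⁱ(Y)(r)` are the shifted pieces (g31-#1 `HodgeModel.piece_tateTwist_cast_int`)
        exact Or.inr ((HodgeModel.piece_tateTwist_cast_int hY (BettiUniverse.realHodgeModel hHD hY) (BettiUniverse.realHodgeModel_isHodgeSymmetric hHD hY) hw p _).trans h)
    simp only [hφ, LinearMap.zero_apply, map_zero]

end Disjoint

/-! ### §3 Example: a curve times a threefold with `h^{2,1} = 0` -/

section CurveThreefold

variable {d : ℕ} {C T : SchemeOver ℂ}

variable [HodgeTensorFacts.{0, 0}]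

/-- **`HC(C × T)` for every smooth projective curve `C` and every smooth projective threefold `T` with `H³(T)^{2,1} = 0`** (e.g. a rigid Calabi–Yau threefold): the only reduced-window piece is
`H¹(C) ⊗ H³(T) ⊂ H⁴(C × T)`, i.e. `Hom_HS(H³(T), H¹(C)(−1))`, and `H¹(C)(−1)` is of types `(2,1)`, `(1,2)` while `H³(T)` has `h^{2,1} = h^{1,2} = 0` — a Hodge-disjoint window (§2; `HC` in dimension
`≤ 3` is the tree's `hodgeConjectureFor_of_dim_le_three_holds`). [cite: VoisinHodgeI2002, §7.1.1, §11.3.3 Thm. 11.38–11.40, Lemma 11.41 and pp. 285–287, §11.3.1 Thm. 11.30] [cite: VoisinHodgeII2003, §10.2.3 proof of Prop. 10.26]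
[cite: DeligneHodgeII1971, 1.2.5 and 2.1.13] [cite: Deligne2000, §1] -/
theorem BettiUniverse.hodgeConjectureFor_curve_tensor_threefold_of_piece_two_one_eq_bot (hHD : exists_isReal_hodgeModel) (hC : IsSmoothProjective 1 C) (hT : IsSmoothProjective 3 T)
    (hCT : IsSmoothProjective d (C ⊗ T)) (h21 : (BettiUniverse.hodge hHD hT 3).piece 2 1 = ⊥) : HodgeConjectureFor d (C ⊗ T) := by
  -- Hodge symmetry: `H³(T)^{1,2} = 0` as well
  have h12 : (BettiUniverse.hodge hHD hT 3).piece 1 2 = ⊥ := by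
    rw [Submodule.eq_bot_iff]
    intro x hx
    set e := (BettiUniverse.hodge hHD hT 3).conjPieceEquiv 1 2 with he
    have hmem : ((e ⟨x, hx⟩ : (BettiUniverse.hodge hHD hT 3).piece 2 1) : ℂ ⊗[ℚ] bettiCohomology T 3) ∈ (⊥ : Submodule ℂ (ℂ ⊗[ℚ] bettiCohomology T 3)) :=
      h21.le (e ⟨x, hx⟩).2
    rw [Submodule.mem_bot] at hmem
    have h0 : e ⟨x, hx⟩ = 0 := Subtype.ext hmem
    have hx0 : (⟨x, hx⟩ : (BettiUniverse.hodge hHD hT 3).piece 1 2) = 0 := e.injective (h0.trans (map_zero e).symm)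
    exact congrArg Subtype.val hx0
  refine BettiUniverse.hodgeConjectureFor_tensor_of_forall_reducedWindow_hodgeDisjoint hHD hC hT hCT (hodgeConjectureFor_of_dim_le_three_holds (by norm_num) hC)
    (hodgeConjectureFor_of_dim_le_three_holds le_rfl hT) fun c i j a r hc hi him hj hjn hij haj hr _ _ _ _ p ↦ ?_
  -- the only reduced-window piece: `i = 1`, `j = 3`, `c = 2`, `a = 3`, `r = −1`
  obtain rfl : i = 1 := by omega
  obtain rfl : j = 3 := by omega
  obtain rfl : c = 2 := by omega
  obtain rfl : a = 3 := by omega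
  obtain rfl : r = -1 := by omega
  by_cases hp1 : p = 1
  · subst hp1
    left
    rw [show ((3 : ℕ) : ℤ) - 1 = 2 by norm_num]
    exact h12
  by_cases hp2 : p = 2
  · subst hp2
    left
    rw [show ((3 : ℕ) : ℤ) - 2 = 1 by norm_num]
    exact h21
  · -- `H¹(C)` has no piece with a negative index
    right
    by_cases hp0 : p ≤ 0
    · exact HodgeModel.hodgeStructure_piece_eq_bot_of_neg hC (BettiUniverse.realHodgeModel hHD hC) (BettiUniverse.realHodgeModel_isHodgeSymmetric hHD hC) 1 (Or.inl (by omega))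
    · exact HodgeModel.hodgeStructure_piece_eq_bot_of_neg hC (BettiUniverse.realHodgeModel hHD hC) (BettiUniverse.realHodgeModel_isHodgeSymmetric hHD hC) 1 (Or.inr (by push_cast; omega))

end CurveThreefold

end Literature.AlgebraicGeometry.HodgeTheory

end
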